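import Summits.QuantumFields.YangMills.Theorems.UnitScaleTiltProp7TubeStrGaugeComparison
import HarnessLib

/-!
# Route `UnitScaleTilt`, crux «MinimiserStabilityRegPr» (stmt-QuantumFields-19200, stub EX), γ-row `hGF[Lift]` (LOD line; w5 g13's (L6) knit ✓`Prop7LODAssembly.curvedTarget_of_LOD_topMean`,
# slot `hK₃` ← routeR-w4 g26, chair BOOK 2026-08-30 00:45:36Z) — ★ THE PLAIN TUBE BOUND AND THE FLAT `ℓ²` BOUND OF THE AVERAGING OPERATOR OF RECORD:
# `Σ_c |T^{str}_V Y(c)|² ≤ ℓ^d·ℓ²·Σ_b |Y b|²` (any `U1`-valued transporter field `V`, any `Y`) and `Σ_{c'} |QTwS 1 Y c'|² ≤ (ℓ²∕ℓ^d)·Σ_b |Y b|²`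

Cell `ym3-torus` (rung R3 — YM₃ on T³; NOT d = 4, NOT the Clay problem).  Width seat `ym-routeR-w4` g26.  THEOREMS ONLY (0 `def`, 0 `sorry`); `--supports stmt-QuantumFields-19200 --as helper`;
count-neutral.  FILE 1a of the `hK₃` pen (1b = ✓∕⧗`Prop7QTwSEllTwoBound`: the curved bound; 2 = the cutoff commutator `[Q_k(U₀), χ]`).

THE POINT.  `hK₃` (`a·Σ_j ‖Q_k(U₀)(M_jA) − N₃ʲ(Q_k(U₀)A)‖² ≤ κ₃²‖A‖²`) is a commutator estimate whose size is `‖Q_k(U₀)‖_{ℓ²→ℓ²} × sup|χ_j − χ_j(x₀)|` on the read set; the tree has the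
REVERSE tube row (✓`tubeRowC_of_regPr`) but no named `ℓ²` bound OF `QTwS U₀`.  The elementary half is here: the corner tube functional
`T^{str}_V Y(c) = Σ_rΣ_{t<ℓ} Ad_{V(comb_r)V(run_{r,t})} Y(b_{r,t}(c))` has `ℓ^d·ℓ` terms with unitary weights and every fine bond occurs `ℓ` times over all `(c, r, t)`
(✓`Prop7TubeStrSubStairLineIter.sq_sum_tube_le` ∕ `sum_tube_eq`), so `Σ_c |T^{str}_V Y(c)|² ≤ ℓ^d·ℓ·ℓ·Σ_b |Y b|²`; and `QTwS 1 Y c' = ℓ^{−d}·`(plain tube sum at `ĉ`)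
(✓`Prop7TubeStrGaugeComparison.plainTube_eq_smul_QTwS_one`) gives the flat bound in the `(ℓ²∕ℓ^d)` currency of ✓p751052.
WHAT IS PROVED: §0 `normSq_le_three`, `sum_normSq_add_three_le`, `sum_normSq_smul_one` (algebra); §1 ★`sum_normSq_tubeStr_le`, `sum_normSq_plainTube_le`, ★`sum_normSq_QTwS_one_le`.
HONEST SCOPE.  Counting over landed rows; `hK₃`, the knit's slots, `hT`, `hGF`, the print rows, `hThm2S`, EX and the crux are NOT proved here.
References: T. Bałaban, CMP **95** (1984) 17–40 [Balaban1984PropagatorsI] ((1.18)–(1.20) pp.19–20); CMP **98** (1985) 17–51 [Balaban1985Averaging] ((19)–(20) p.21, (125)–(127) p.36).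
-/

set_option autoImplicit false

noncomputable section

open scoped BigOperators Matrix.Norms.L2Operator Matrix

namespace Summit.QuantumFields.YangMills.Theorems.Prop7QTwSEllTwoPlainTube

open Literature.MathematicalPhysics.QuantumFieldTheory.Balaban1983to89
open Literature.MathematicalPhysics.QuantumFieldTheory.Balaban1983to89.T3ContinuumYM3Torus
open Finset T4Continuum BlockAveraging AveragingRT ExpMeanLog BlockAveragingEMLLinearised BlockAveragingEMLLinearisedBackground BlockAveragingEMLProp2 LatticeFieldCalculus
open B7Prop1Explicit (U1 mem_U1 treeWord)
open B7Eq78Linearization (conjR)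
open B8Ineq132 (norm_conjR)
open B10Eq27TorusAxialLog (holT unitsField toUField)
open T3LevelShift (bondShift)
open T3PrintedRegularOrbits (sites_eq)
open Summit.QuantumFields.YangMills.Theorems.Prop7SymAvgTwSym (QTwS holT_mem_U1)
open Summit.QuantumFields.YangMills.Theorems.Prop7TubeStrSubStairLineIter (sum_tube_eq sq_sum_tube_le)
open Summit.QuantumFields.YangMills.Theorems.Prop7TubeStrGaugeComparison (plainTube_eq_smul_QTwS_one)

variable (F : T3Family) (n K : ℕ)

/-! ## §0 Three small algebra rows (used by FILE 1b) -/

/-- algebra: `‖x‖² ≤ 3(‖a‖² + ‖b‖² + ‖c‖²)` when `x = a − b + c`. [folklore] -/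
theorem normSq_le_three {E : Type*} [SeminormedAddCommGroup E] (a b c : E) :
    ‖a - b + c‖ ^ 2 ≤ 3 * (‖a‖ ^ 2 + ‖b‖ ^ 2 + ‖c‖ ^ 2) := by
  have h1 : ‖a - b + c‖ ≤ ‖a‖ + ‖b‖ + ‖c‖ := by
    calc ‖a - b + c‖ ≤ ‖a - b‖ + ‖c‖ := norm_add_le _ _
      _ ≤ (‖a‖ + ‖b‖) + ‖c‖ := by gcongr; exact norm_sub_le _ _
  have h0 : 0 ≤ ‖a‖ + ‖b‖ + ‖c‖ := by positivity
  nlinarith [pow_le_pow_left₀ (norm_nonneg _) h1 2, sq_nonneg (‖a‖ - ‖b‖), sq_nonneg (‖b‖ - ‖c‖), sq_nonneg (‖a‖ - ‖c‖)]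

/-- entrywise: `Σ_{jk}|(a + b + c)_{jk}|² ≤ 3·(Σ|a_{jk}|² + Σ|b_{jk}|² + Σ|c_{jk}|²)`. [folklore] -/
theorem sum_normSq_add_three_le (a b c : Matrix (Fin 2) (Fin 2) ℂ) :
    ∑ j, ∑ k, ‖(a + b + c) j k‖ ^ 2 ≤ 3 * (∑ j, ∑ k, ‖a j k‖ ^ 2 + ∑ j, ∑ k, ‖b j k‖ ^ 2 + ∑ j, ∑ k, ‖c j k‖ ^ 2) := by
  rw [mul_add, mul_add, Finset.mul_sum, Finset.mul_sum, Finset.mul_sum, ← Finset.sum_add_distrib, ← Finset.sum_add_distrib]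
  refine Finset.sum_le_sum fun j _ => ?_
  rw [Finset.mul_sum, Finset.mul_sum, Finset.mul_sum, ← Finset.sum_add_distrib, ← Finset.sum_add_distrib]
  refine Finset.sum_le_sum fun k _ => ?_
  rw [Matrix.add_apply, Matrix.add_apply]
  have h1 : ‖a j k + b j k + c j k‖ ≤ ‖a j k‖ + ‖b j k‖ + ‖c j k‖ := norm_add₃_le
  have h0 : 0 ≤ ‖a j k‖ + ‖b j k‖ + ‖c j k‖ := by positivity
  nlinarith [pow_le_pow_left₀ (norm_nonneg _) h1 2, sq_nonneg (‖a j k‖ - ‖b j k‖), sq_nonneg (‖b j k‖ - ‖c j k‖), sq_nonneg (‖a j k‖ - ‖c j k‖)]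

/-- The scalar sector in Hilbert–Schmidt currency: `Σ_{jk} |(s•1)_{jk}|² = 2|s|²`. [folklore] -/
theorem sum_normSq_smul_one (s : ℂ) : ∑ j : Fin 2, ∑ k : Fin 2, ‖(s • (1 : Matrix (Fin 2) (Fin 2) ℂ)) j k‖ ^ 2 = 2 * ‖s‖ ^ 2 := by
  simp [Matrix.smul_apply, Matrix.one_apply, Fin.sum_univ_two]
  ring

/-! ## §1 The plain tube bound -/

section Plain

variable (h : n ≤ K)

/-- ★ **THE PLAIN TUBE BOUND**: for a `U1`-valued transporter field `V` and any bond field `Y`, the corner tube functional `T^{str}_V Y(c) = Σ_rΣ_{t<ℓ} Ad_{V(comb)V(run)} Y(b_{r,t}(c))`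
satisfies `Σ_c |T^{str}_V Y(c)|² ≤ ℓ^d·ℓ²·Σ_b |Y b|²` (Cauchy–Schwarz over the `ℓ^d·ℓ` terms, `|Ad_u Y| = |Y|`, each fine bond met `ℓ` times in all).
[cite: Balaban1984PropagatorsI, (1.18) p.20; Balaban1985Averaging, (19)-(20) p.21, (125)-(127) p.36] -/
theorem sum_normSq_tubeStr_le (V : GaugeField (F.P K) 0 (Matrix (Fin 2) (Fin 2) ℂ)ˣ) (hV : ∀ b, V b ∈ U1 (Matrix (Fin 2) (Fin 2) ℂ)) (Y : PBond (F.P K) 0 → Matrix (Fin 2) (Fin 2) ℂ) :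
    ∑ c : PBond (F.P K) (K - n), ‖(∑ r : Fin (F.P K).d → Fin ((F.P K).L ^ (K - n)), ∑ t ∈ Finset.range ((F.P K).L ^ (K - n)),
        conjR (holT V (Site.fibreSite 0 (K - n) (c).src fun _ => (⟨0, pow_pos (F.P K).L_pos (K - n)⟩ : Fin ((F.P K).L ^ (K - n)))) (treeWord fun ν => ((r ν : ℕ) : ℤ))
            * holT V (Site.fibreSite 0 (K - n) (c).src r) (List.replicate t ((c).dir, true)))
          (Y ⟨(fun z : Site (F.P K) 0 => z.shift (c).dir)^[t] (Site.fibreSite 0 (K - n) (c).src r), (c).dir⟩))‖ ^ 2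
      ≤ (((F.L : ℝ) ^ (K - n)) ^ (F.P K).d * ((F.L : ℝ) ^ (K - n)) ^ 2) * ∑ b : PBond (F.P K) 0, ‖Y b‖ ^ 2 := by
  classical
  have hk : K - n ≤ (F.P K).m + (F.P K).K := by show K - n ≤ F.m + K; omega
  have hLL : ((F.P K).L : ℝ) = F.L := rfl
  -- per tube: Cauchy–Schwarz with unitary weights
  have hper : ∀ c : PBond (F.P K) (K - n), ‖(∑ r : Fin (F.P K).d → Fin ((F.P K).L ^ (K - n)), ∑ t ∈ Finset.range ((F.P K).L ^ (K - n)),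
        conjR (holT V (Site.fibreSite 0 (K - n) (c).src fun _ => (⟨0, pow_pos (F.P K).L_pos (K - n)⟩ : Fin ((F.P K).L ^ (K - n)))) (treeWord fun ν => ((r ν : ℕ) : ℤ))
            * holT V (Site.fibreSite 0 (K - n) (c).src r) (List.replicate t ((c).dir, true)))
          (Y ⟨(fun z : Site (F.P K) 0 => z.shift (c).dir)^[t] (Site.fibreSite 0 (K - n) (c).src r), (c).dir⟩))‖ ^ 2
      ≤ (((F.L : ℝ) ^ (K - n)) ^ (F.P K).d * ((F.L : ℝ) ^ (K - n))) * ∑ r : Fin (F.P K).d → Fin ((F.P K).L ^ (K - n)), ∑ t ∈ Finset.range ((F.P K).L ^ (K - n)),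
          ‖Y ⟨(fun z : Site (F.P K) 0 => z.shift c.dir)^[t] (Site.fibreSite 0 (K - n) c.src r), c.dir⟩‖ ^ 2 := by
    intro c
    have h1 : ‖(∑ r : Fin (F.P K).d → Fin ((F.P K).L ^ (K - n)), ∑ t ∈ Finset.range ((F.P K).L ^ (K - n)),
        conjR (holT V (Site.fibreSite 0 (K - n) (c).src fun _ => (⟨0, pow_pos (F.P K).L_pos (K - n)⟩ : Fin ((F.P K).L ^ (K - n)))) (treeWord fun ν => ((r ν : ℕ) : ℤ))
            * holT V (Site.fibreSite 0 (K - n) (c).src r) (List.replicate t ((c).dir, true)))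
          (Y ⟨(fun z : Site (F.P K) 0 => z.shift (c).dir)^[t] (Site.fibreSite 0 (K - n) (c).src r), (c).dir⟩))‖
        ≤ ∑ r : Fin (F.P K).d → Fin ((F.P K).L ^ (K - n)), ∑ t ∈ Finset.range ((F.P K).L ^ (K - n)),
            ‖Y ⟨(fun z : Site (F.P K) 0 => z.shift c.dir)^[t] (Site.fibreSite 0 (K - n) c.src r), c.dir⟩‖ := by
      refine (norm_sum_le _ _).trans (Finset.sum_le_sum fun r _ => (norm_sum_le _ _).trans (Finset.sum_le_sum fun t _ => le_of_eq ?_))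
      exact norm_conjR ((U1 _).mul_mem (holT_mem_U1 hV _ _) (holT_mem_U1 hV _ _)) _
    have h0 : 0 ≤ ‖(∑ r : Fin (F.P K).d → Fin ((F.P K).L ^ (K - n)), ∑ t ∈ Finset.range ((F.P K).L ^ (K - n)),
        conjR (holT V (Site.fibreSite 0 (K - n) (c).src fun _ => (⟨0, pow_pos (F.P K).L_pos (K - n)⟩ : Fin ((F.P K).L ^ (K - n)))) (treeWord fun ν => ((r ν : ℕ) : ℤ))
            * holT V (Site.fibreSite 0 (K - n) (c).src r) (List.replicate t ((c).dir, true)))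
          (Y ⟨(fun z : Site (F.P K) 0 => z.shift (c).dir)^[t] (Site.fibreSite 0 (K - n) (c).src r), (c).dir⟩))‖ := norm_nonneg _
    refine (pow_le_pow_left₀ h0 h1 2).trans ?_
    have h2 := sq_sum_tube_le (P := F.P K) (k := K - n)
      (fun r t => ‖Y ⟨(fun z : Site (F.P K) 0 => z.shift c.dir)^[t] (Site.fibreSite 0 (K - n) c.src r), c.dir⟩‖)
    rw [hLL] at h2
    exact h2
  refine (Finset.sum_le_sum fun c _ => hper c).trans ?_
  rw [← Finset.mul_sum, sum_tube_eq hk (fun b => ‖Y b‖ ^ 2), hLL]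
  ring_nf
  rfl

/-- The transporter-free twin: `Σ_c |Σ_rΣ_{t<ℓ} Y(b_{r,t}(c))|² ≤ ℓ^d·ℓ²·Σ_b |Y b|²`. [cite: Balaban1984PropagatorsI, (1.18) p.20] -/
theorem sum_normSq_plainTube_le (Y : PBond (F.P K) 0 → Matrix (Fin 2) (Fin 2) ℂ) :
    ∑ c : PBond (F.P K) (K - n), ‖(∑ r : Fin (F.P K).d → Fin ((F.P K).L ^ (K - n)), ∑ t ∈ Finset.range ((F.P K).L ^ (K - n)),
          Y ⟨(fun z : Site (F.P K) 0 => z.shift (c).dir)^[t] (Site.fibreSite 0 (K - n) (c).src r), (c).dir⟩)‖ ^ 2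
      ≤ (((F.L : ℝ) ^ (K - n)) ^ (F.P K).d * ((F.L : ℝ) ^ (K - n)) ^ 2) * ∑ b : PBond (F.P K) 0, ‖Y b‖ ^ 2 := by
  classical
  have hk : K - n ≤ (F.P K).m + (F.P K).K := by show K - n ≤ F.m + K; omega
  have hLL : ((F.P K).L : ℝ) = F.L := rfl
  have hper : ∀ c : PBond (F.P K) (K - n), ‖(∑ r : Fin (F.P K).d → Fin ((F.P K).L ^ (K - n)), ∑ t ∈ Finset.range ((F.P K).L ^ (K - n)),
          Y ⟨(fun z : Site (F.P K) 0 => z.shift (c).dir)^[t] (Site.fibreSite 0 (K - n) (c).src r), (c).dir⟩)‖ ^ 2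
      ≤ (((F.L : ℝ) ^ (K - n)) ^ (F.P K).d * ((F.L : ℝ) ^ (K - n))) * ∑ r : Fin (F.P K).d → Fin ((F.P K).L ^ (K - n)), ∑ t ∈ Finset.range ((F.P K).L ^ (K - n)),
          ‖Y ⟨(fun z : Site (F.P K) 0 => z.shift c.dir)^[t] (Site.fibreSite 0 (K - n) c.src r), c.dir⟩‖ ^ 2 := by
    intro c
    have h1 : ‖(∑ r : Fin (F.P K).d → Fin ((F.P K).L ^ (K - n)), ∑ t ∈ Finset.range ((F.P K).L ^ (K - n)),
          Y ⟨(fun z : Site (F.P K) 0 => z.shift (c).dir)^[t] (Site.fibreSite 0 (K - n) (c).src r), (c).dir⟩)‖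
        ≤ ∑ r : Fin (F.P K).d → Fin ((F.P K).L ^ (K - n)), ∑ t ∈ Finset.range ((F.P K).L ^ (K - n)),
            ‖Y ⟨(fun z : Site (F.P K) 0 => z.shift c.dir)^[t] (Site.fibreSite 0 (K - n) c.src r), c.dir⟩‖ :=
      (norm_sum_le _ _).trans (Finset.sum_le_sum fun r _ => norm_sum_le _ _)
    refine (pow_le_pow_left₀ (norm_nonneg _) h1 2).trans ?_
    have h2 := sq_sum_tube_le (P := F.P K) (k := K - n)
      (fun r t => ‖Y ⟨(fun z : Site (F.P K) 0 => z.shift c.dir)^[t] (Site.fibreSite 0 (K - n) c.src r), c.dir⟩‖)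
    rw [hLL] at h2
    exact h2
  refine (Finset.sum_le_sum fun c _ => hper c).trans ?_
  rw [← Finset.mul_sum, sum_tube_eq hk (fun b => ‖Y b‖ ^ 2), hLL]
  ring_nf
  rfl

/-- ★ **THE FLAT BOUND**: `Σ_{c'} |QTwS 1 Y c'|² ≤ (ℓ²∕ℓ^d)·Σ_b |Y b|²` for every bond field `Y` (`QTwS 1 = ℓ^{−d}·`plain tube sum, ✓`plainTube_eq_smul_QTwS_one`).
[cite: Balaban1984PropagatorsI, (1.18) p.20; Balaban1985Averaging, (125)-(127) p.36] -/
theorem sum_normSq_QTwS_one_le (Y : PBond (F.P K) 0 → Matrix (Fin 2) (Fin 2) ℂ) :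
    ∑ c' : PBond (F.P n) 0, ‖QTwS F n K h (1 : GaugeField (F.P K) 0 (Matrix.specialUnitaryGroup (Fin 2) ℂ)) Y c'‖ ^ 2
      ≤ (((F.L : ℝ) ^ (K - n)) ^ 2 / ((F.L : ℝ) ^ (K - n)) ^ (F.P K).d) * ∑ b : PBond (F.P K) 0, ‖Y b‖ ^ 2 := by
  classical
  have hL3 : (3 : ℝ) ≤ F.L := by
    have h3 : 3 ≤ F.L := by obtain ⟨a, ha⟩ := F.hL.1; have := F.hL.2; omega
    exact_mod_cast h3
  have hL0 : (0 : ℝ) < F.L := by linarith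
  have hℓd0 : (0 : ℝ) < ((F.L : ℝ) ^ (K - n)) ^ (F.P K).d := by positivity
  have hld : ((((F.P K).L : ℂ) ^ (K - n)) ^ (F.P K).d) = (((((F.L : ℝ) ^ (K - n)) ^ (F.P K).d : ℝ)) : ℂ) := by push_cast; rfl
  -- `|QTwS 1 Y c'| = ℓ^{-d}·|plain tube sum at ĉ|`
  have hper : ∀ c' : PBond (F.P n) 0, ‖QTwS F n K h (1 : GaugeField (F.P K) 0 (Matrix.specialUnitaryGroup (Fin 2) ℂ)) Y c'‖ ^ 2
      = ((((F.L : ℝ) ^ (K - n)) ^ (F.P K).d) ^ 2)⁻¹ * ‖(∑ r : Fin (F.P K).d → Fin ((F.P K).L ^ (K - n)), ∑ t ∈ Finset.range ((F.P K).L ^ (K - n)),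
          Y ⟨(fun z : Site (F.P K) 0 => z.shift (bondShift (sites_eq F n K h) c').dir)^[t] (Site.fibreSite 0 (K - n) (bondShift (sites_eq F n K h) c').src r), (bondShift (sites_eq F n K h) c').dir⟩)‖ ^ 2 := by
    intro c'
    rw [plainTube_eq_smul_QTwS_one F n K h Y c', hld, norm_smul, Complex.norm_real, Real.norm_of_nonneg hℓd0.le, mul_pow, ← mul_assoc,
      inv_mul_cancel₀ (pow_ne_zero _ hℓd0.ne'), one_mul]
  simp only [hper]
  rw [← Finset.mul_sum]
  have hre : ∑ c' : PBond (F.P n) 0, ‖(∑ r : Fin (F.P K).d → Fin ((F.P K).L ^ (K - n)), ∑ t ∈ Finset.range ((F.P K).L ^ (K - n)),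
          Y ⟨(fun z : Site (F.P K) 0 => z.shift (bondShift (sites_eq F n K h) c').dir)^[t] (Site.fibreSite 0 (K - n) (bondShift (sites_eq F n K h) c').src r), (bondShift (sites_eq F n K h) c').dir⟩)‖ ^ 2
      = ∑ c : PBond (F.P K) (K - n), ‖(∑ r : Fin (F.P K).d → Fin ((F.P K).L ^ (K - n)), ∑ t ∈ Finset.range ((F.P K).L ^ (K - n)),
          Y ⟨(fun z : Site (F.P K) 0 => z.shift (c).dir)^[t] (Site.fibreSite 0 (K - n) (c).src r), (c).dir⟩)‖ ^ 2 :=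
    Fintype.sum_equiv (bondShift (sites_eq F n K h)) _ (fun c : PBond (F.P K) (K - n) => ‖(∑ r : Fin (F.P K).d → Fin ((F.P K).L ^ (K - n)), ∑ t ∈ Finset.range ((F.P K).L ^ (K - n)),
          Y ⟨(fun z : Site (F.P K) 0 => z.shift (c).dir)^[t] (Site.fibreSite 0 (K - n) (c).src r), (c).dir⟩)‖ ^ 2) (fun _ => rfl)
  rw [hre]
  refine (mul_le_mul_of_nonneg_left (sum_normSq_plainTube_le F n K Y) (by positivity)).trans (le_of_eq ?_)
  field_simp

end Plain

end Summit.QuantumFields.YangMills.Theorems.Prop7QTwSEllTwoPlainTube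

end
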